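import Summits.KontsevichZagierPeriods.KontsevichZagierPeriods.Theses.CobordismMove

/-!
# `KernelFormGlue` (stmt-KontsevichZagierPeriods-14317, route CobordismMove)

The plain kernel form of the Kontsevich–Zagier period conjecture for the calculus of moves —
every formal `ℤ`-combination of integral representations with value `0` lies in
`Literature.NumberTheory.Transcendental.KZ.relations` — implies the route's enlarged-kernel
target `TopologicalMovesKernel`, simply because
`KZ.relations = AddSubgroup.closure (moves) ≤
  AddSubgroup.closure (moves ∪ cube-Stokes relators ∪ signed-sheet relators)`
(monotonicity of `AddSubgroup.closure`; the generating set of `KZ.relations` is literally the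
left-most member of the union generating the enlarged subgroup).

`KernelFormGlue_proof` concludes the route declaration
`Summit.KontsevichZagierPeriods.KontsevichZagierPeriods.Theses.CobordismMove.KernelFormGlue`
by name. No definitions are introduced.

References: M. Kontsevich, D. Zagier, *Periods* (2001), §1.2; A. Huber, S. Müller-Stach,
*Periods and Nori Motives* (2017), §13.1 (kernel reformulation of the period conjecture).
-/

namespace Summit.KontsevichZagierPeriods.CobordismMove.KernelFormGlue

open Summit.KontsevichZagierPeriods.KontsevichZagierPeriods.Theses.CobordismMove

/-- Settles stmt-KontsevichZagierPeriods-14317 (`KernelFormGlue`): if every formal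
`ℤ`-combination of integral representations with value `0` lies in `KZ.relations` (the subgroup
of `KZ.FormalRep` generated by the four moves), then it lies a fortiori in the subgroup generated
by the four moves together with the cube-Stokes relators and the signed-sheet relators, i.e.
`TopologicalMovesKernel` holds.
Proof: `AddSubgroup.closure` is monotone (`AddSubgroup.closure_mono`) and
`moves ⊆ (moves ∪ cubeStokes) ∪ signedSheet` (`Set.subset_union_left` twice). [folklore] -/
theorem KernelFormGlue_proof : KernelFormGlue := by
  unfold KernelFormGlue TopologicalMovesKernel
  intro hk c h0
  exact AddSubgroup.closure_mono (Set.subset_union_left.trans Set.subset_union_left) (hk c h0)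

end Summit.KontsevichZagierPeriods.CobordismMove.KernelFormGlue
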